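import Summits.Ventures.YMGap.RobustBall.TorusRowsSU2Star
import Summits.Ventures.YMGap.RobustBall.TorusDoorFine
import HarnessLib

/-!
# Venture YMGap, track ROBUST-BALL (Y2) — crux Y2-X2, step 8: the robust vertex-star door on the READS-INCIDENCE
# (fine) tier-1 ball `ClusterDomainFRFine ε₀ ε₁ r`

HONEST FRAMING. WHAT THIS IS: a venture file (cell `pub-ymgap`, track Y2 ROBUST-BALL, seat ds-2): the door of
`RobustStarDoor` with every load replaced by its reads-incidence version (`FineBall.oscLoadF / selfLipLoadF / crossLipF /
crossLipLoadF`; single-link matrix `TorusDoorFine.isKRContraction_perturbedTorusSpec_fine_of_hasRange`). Since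
`ClusterDomainFRFine ⊇ ClusterDomainFR` (`mem_fine_of_mem`) this is the STRONGER statement with the SAME door condition and the
SAME constants (named-action windows are `×d` wider on the fine ball, p1's count): `clustersWith_of_robustStar_fine`,
`torusClusteringOnBallFine_of_robustStar`, and the `SU(2)`, `d = 4` schema + rows at tree coupling `β_W/2`:
(1/8, .148) and (1/4, .055) on `ClusterDomainFRFine (2ε) ε r` (certificates of `TorusRowsSU2Star`). WHAT THIS IS NOT: no new
analysis; radii are door artefacts; lattice statements on finite tori — nothing about the continuum or the Millennium problem.

## References
* The tree: `RobustStarDoor.lean`, `TorusRowsSU2Star.lean` (this seat), `FineBall.lean` (rb-theory), `TorusDoorFine.lean` (ds-2 g6).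
-/

noncomputable section

open MeasureTheory ProbabilityTheory Function Finset
open Literature.Probability.LatticeModels
open Literature.Probability.LatticeModels.DobrushinMetric
open Literature.MathematicalPhysics.QuantumLattice (fundamentalRep)
open Literature.MathematicalPhysics.QuantumFieldTheory hiding ZdEdge
open Literature.MathematicalPhysics.QuantumFieldTheory.Balaban1983to89.StrongCouplingTorusWindow
open Literature.MathematicalPhysics.QuantumFieldTheory.Balaban1983to89.StrongCouplingDobrushinWindow
  (OneLinkKRModulus)
open Summit.Ventures.YMGap.DSWindow
open Summit.Ventures.YMGap.StarKernel
open Summit.Ventures.YMGap.StarResolventDim (Delta gaugeR doorPoly Delta_pos_of_door gaugeR_lt_one_of_door)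
open Summit.Ventures.YMGap.StarLemmaGDim
open Summit.Ventures.YMGap.RobustStar

namespace Summit.Ventures.YMGap.RobustBall

variable {d L N : ℕ} [NeZero L]

/-! ### One member of the fine ball -/

/-- **THE ROBUST STAR DOOR FOR ONE MEMBER OF THE READS-INCIDENCE BALL ⇒ `ClustersWith`** (same constants as
`clustersWith_of_robustStar`; the loads are the fine ones of `FineBall`, the Dobrushin matrix is
`TorusDoorFine.isKRContraction_perturbedTorusSpec_fine_of_hasRange`). [folklore] -/
theorem clustersWith_of_robustStar_fine (hd : 2 ≤ d) (hN : 1 ≤ N) (hL : 3 ≤ L) {β ε₀ ε₁ R K c lam θ ρ : ℝ} {r Kn : ℕ}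
    (hK : 0 ≤ K) (hR : |β| / N * (2 * ((d : ℝ) - 1)) ≤ R) (hmod : OneLinkKRModulus N R K) (hε₁ : 0 ≤ ε₁)
    (hc : K * Real.exp ε₀ * (1 + 2 * Real.sqrt N * ε₁) * (|β| / N) ≤ c) (hlam : Real.sqrt N * ε₁ ≤ lam)
    (hθ : θ = (2 * (d : ℝ) - 2) * c + lam) (hθ1 : θ < 1) (hcd : doorPoly d c < 1)
    (hρ : ρ = gaugeR d c + (lam + θ ^ Kn * (4 * d * lam)) / (1 - θ)) (hρ1 : ρ < 1)
    {W : Perturbation d L N} (hW : W ∈ ClusterDomainFRFine ε₀ ε₁ r) :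
    ClustersWith W β
      (4 * (2 * Real.sqrt N) ^ 2 * Real.exp (2 * ((1 - ρ) ^ 2 / (2 * (2 * ρ * (2 * d : ℕ) + 1)))))
      ((1 - ρ) ^ 2 / (2 * (2 * ρ * (2 * d : ℕ) + 1)) / ((max r 1 + 2 : ℕ) : ℝ)) := by
  classical
  obtain ⟨hr, w, hwa, hwℓ⟩ := hW
  have hL1 : 1 < L := by omega
  have hd1 : 1 ≤ d := by omega
  have hc0 : 0 ≤ c := le_trans (by positivity) hc
  have hlam0 : 0 ≤ lam := le_trans (by positivity) hlam
  have hΔ : 0 < Delta d c := Delta_pos_of_door hd hc0 hcd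
  have hgR : 0 ≤ gaugeR d c ∧ gaugeR d c < 1 := gaugeR_lt_one_of_door hd hc0 hcd
  have hd2 : (2 : ℝ) ≤ d := by exact_mod_cast hd
  have hθ0 : 0 ≤ θ := by rw [hθ]; nlinarith
  have h1θ : 0 < 1 - θ := by linarith
  have hρ0 : 0 ≤ ρ := by
    rw [hρ]
    refine add_nonneg hgR.1 (div_nonneg (add_nonneg hlam0 ?_) h1θ.le)
    have : 0 ≤ θ ^ Kn := pow_nonneg hθ0 Kn
    positivity
  -- the robust single-link matrix, extended to all links with the off-column array `E`
  set nbr : Edge d L → Finset (Edge d L) := fun e => (univ.erase e).filter fun y => torusNorm (e.1 - y.1) ≤ max r 1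
    with hnbr
  set E : Edge d L → Edge d L → ℝ := fun x z => if z ∈ nbr x then Real.sqrt N * w.crossLipF 0 x z else 0 with hEdef
  have hE0 : ∀ x z, 0 ≤ E x z := fun x z => by
    simp only [hEdef]; split_ifs
    · exact mul_nonneg (Real.sqrt_nonneg _) (crossLipF_nonneg w 0 x z)
    · exact le_rfl
  have hKR := isKRContraction_perturbedTorusSpec_fine_of_hasRange hd1 hN hL1 hK hR hmod w hr
  have hcoef : ∀ x : Edge d L,
      K * Real.exp (w.oscLoadF 0 x) * (1 + 2 * Real.sqrt N * w.selfLipLoadF 0 x) * (|β| / N) ≤ c := by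
    intro x
    refine le_trans ?_ hc
    have h1 : Real.exp (w.oscLoadF 0 x) ≤ Real.exp ε₀ := Real.exp_le_exp.2 (hwa x)
    have h2 : w.selfLipLoadF 0 x ≤ ε₁ := by linarith [hwℓ x, crossLipLoadF_nonneg w 0 x]
    have h3 : 0 ≤ w.selfLipLoadF 0 x := selfLipLoadF_nonneg w 0 x
    gcongr
  have hKR' : IsKRContraction (perturbedTorusSpec W β) suFrobDist (fun e => univ.erase e) (Cst c E) := by
    refine isKRContraction_univ_of_le hKR (fun a b => suFrobDist_nonneg a b) (Cst_nonneg hc0 hE0) fun x y hy => ?_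
    have hEy : E x y = Real.sqrt N * w.crossLipF 0 x y := by simp only [hEdef]; exact if_pos hy
    have ht : (0 : ℝ) ≤ tInfluence x y := Nat.cast_nonneg _
    simp only [Cst]
    rw [hEy]
    nlinarith [mul_nonneg (sub_nonneg.2 (hcoef x)) ht]
  have hlamrow : ∀ x, ∑ z ∈ univ.erase x, E x z ≤ lam := by
    intro x
    calc ∑ z ∈ univ.erase x, E x z ≤ ∑ z ∈ univ.erase x, Real.sqrt N * w.crossLipF 0 x z :=
          sum_le_sum fun z _ => by
            simp only [hEdef]; split_ifs
            · exact le_rfl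
            · exact mul_nonneg (Real.sqrt_nonneg _) (crossLipF_nonneg w 0 x z)
      _ = Real.sqrt N * w.crossLipLoadF 0 x := by rw [← mul_sum]; rfl
      _ ≤ Real.sqrt N * ε₁ := by
          refine mul_le_mul_of_nonneg_left ?_ (Real.sqrt_nonneg _)
          linarith [hwℓ x, selfLipLoadF_nonneg w 0 x]
      _ ≤ lam := hlam
  have hrow : ∀ (s : Site d L), ∀ x ∈ vertexStar s, ∑ z ∈ (vertexStar s).erase x, Cst c E x z ≤ θ := by
    intro s x hx; rw [hθ]; exact sum_star_erase_Cst_le hL hc0 hE0 hlamrow hx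
  -- (H1), (H2), support
  have hcontract := robust_star_window (W := W) (β := β) hd hL hc0 hΔ hE0 hθ0 hθ1 hrow hKR' Kn
  have hsum : ∀ (s : Site d L) (x : Edge d L), x ∈ vertexStar s → ∑ y, Krob c E θ Kn s y x ≤ ρ := by
    intro s x hx; rw [hρ]; exact sum_Krob_le hd hL hc0 hΔ hgR.2.le hE0 hlamrow hθ0 hθ1 (hrow s) hx
  have hKloc : ∀ (s : Site d L) (y x : Edge d L), Krob c E θ Kn s y x ≠ 0 →
      ∀ w' ∈ linkEnds y, torusNorm (s - w') ≤ (max r 1 + 2 : ℕ) := by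
    intro s y x hk w' hw'
    have hyw : torusNorm (y.1 - w') ≤ 1 := torusNorm_fst_sub_linkEnds_le_one hw'
    rcases mem_starBoundary_or_of_Krob_ne_zero hk with hyb | ⟨x', hx', hE'⟩
    · have := torusNorm_le_one_of_mem_starBoundary hyb hw'
      omega
    · have hyn : y ∈ nbr x' := by
        by_contra h
        exact hE' (by simp only [hEdef, if_neg h])
      have hxy : torusNorm (x'.1 - y.1) ≤ max r 1 := (mem_filter.1 hyn).2
      have hsx : torusNorm (s - x'.1) ≤ 1 := torusNorm_sub_fst_le_one_of_mem_vertexStar hx'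
      have t1 := torusNorm_sub_le s x'.1 y.1
      have t2 := torusNorm_sub_le s y.1 w'
      omega
  -- the covariance bound for the member's torus measure
  intro F G ΔF ΔG δF δG n hFm hGm hFdep hGdep hFb hGb hFlip hGlip hdist
  set κ : ℝ := (1 - ρ) ^ 2 / (2 * (2 * ρ * (2 * d : ℕ) + 1)) with hκ
  have hFobs : LinkObs suFrobDist F ΔF δF := ⟨hFm, hFb, hFdep, hFlip.nonneg, hFlip.le⟩
  have hGobs : LinkObs suFrobDist G ΔG δG := ⟨hGm, hGb, hGdep, hGlip.nonneg, hGlip.le⟩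
  have hL₀ : ∀ x ∈ ΔF, ∀ z ∈ ΔG, ∀ a ∈ linkEnds x, ∀ w' ∈ linkEnds z, n - 2 ≤ torusNorm (a - w') :=
    fun x hx z hz a ha w' hw' => le_torusNorm_linkEnds_sub (hdist x hx z hz) ha hw'
  have key := spec_star_abs_covariance_le (isSpecification_perturbedTorusSpec W β)
    (isGibbsMeasure_perturbedMeasure W β) (r := suFrobDist) (R := 2 * Real.sqrt N) (by positivity)
    (fun p q => suFrobDist_le p q) (fun s y x => Krob_nonneg hd hc0 hΔ hE0 hθ0 hθ1 Kn s y x)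
    (ρ₀ := max r 1 + 2) (by omega) hKloc hcontract hρ0 hρ1 hsum hFobs hGobs (n - 2) hL₀
  refine key.trans ?_
  have hκ0 : 0 ≤ κ := by rw [hκ]; have := hρ0; positivity
  have hδF : 0 ≤ ∑ x ∈ ΔF, δF x := Finset.sum_nonneg fun x _ => hFlip.nonneg x
  have hδG : 0 ≤ ∑ y ∈ ΔG, δG y := Finset.sum_nonneg fun y _ => hGlip.nonneg y
  -- depth `⌊(n−2)/ρ₀⌋ ≥ n/ρ₀ − 2`
  set ρ₀ : ℕ := max r 1 + 2 with hρ₀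
  have hρ₀2 : (2 : ℝ) ≤ ρ₀ := by
    have : 2 ≤ ρ₀ := by omega
    exact_mod_cast this
  have hρ₀pos : (0 : ℝ) < ρ₀ := by linarith
  have hq : (n : ℝ) / ρ₀ - 2 ≤ (((n - 2) / ρ₀ : ℕ) : ℝ) := by
    have hdm := Nat.div_add_mod (n - 2) ρ₀
    have hml := Nat.mod_lt (n - 2) (show 0 < ρ₀ by omega)
    have h1 : ((n - 2 : ℕ) : ℝ) < ρ₀ * (((n - 2) / ρ₀ : ℕ) : ℝ) + ρ₀ := by
      have : (n - 2 : ℕ) < ρ₀ * ((n - 2) / ρ₀) + ρ₀ := by omega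
      exact_mod_cast this
    have h2 : (n : ℝ) - 2 ≤ ((n - 2 : ℕ) : ℝ) := by
      rcases Nat.lt_or_ge n 2 with h | h
      · rw [Nat.sub_eq_zero_of_le h.le]
        have : (n : ℝ) < 2 := by exact_mod_cast h
        simp; linarith
      · rw [Nat.cast_sub h]; push_cast; exact le_rfl
    have h3 : (n : ℝ) ≤ ρ₀ * (((n - 2) / ρ₀ : ℕ) : ℝ) + 2 * ρ₀ := by linarith
    have h4 : (n : ℝ) / ρ₀ ≤ (((n - 2) / ρ₀ : ℕ) : ℝ) + 2 := by
      rw [div_le_iff₀ hρ₀pos]; linarith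
    linarith
  have hexp : Real.exp (-(κ * (((n - 2) / ρ₀ : ℕ) : ℝ))) ≤ Real.exp (2 * κ) * Real.exp (-(κ / ρ₀) * n) := by
    rw [← Real.exp_add]
    refine Real.exp_le_exp.2 ?_
    have : κ * ((n : ℝ) / ρ₀ - 2) ≤ κ * (((n - 2) / ρ₀ : ℕ) : ℝ) := mul_le_mul_of_nonneg_left hq hκ0
    have e : -(κ / ρ₀) * n = -(κ * ((n : ℝ) / ρ₀)) := by ring
    rw [e]; nlinarith
  calc 4 * (2 * Real.sqrt N) ^ 2 * Real.exp (-(κ * (((n - 2) / ρ₀ : ℕ) : ℝ))) * (∑ x ∈ ΔF, δF x) * ∑ y ∈ ΔG, δG y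
      ≤ 4 * (2 * Real.sqrt N) ^ 2 * (Real.exp (2 * κ) * Real.exp (-(κ / ρ₀) * n)) * (∑ x ∈ ΔF, δF x) *
          ∑ y ∈ ΔG, δG y := by gcongr
    _ = 4 * (2 * Real.sqrt N) ^ 2 * Real.exp (2 * κ) * (∑ y ∈ ΔG, δG y) * (∑ x ∈ ΔF, δF x) *
          Real.exp (-(κ / ρ₀) * n) := by ring

/-! ### The fine ball, uniformly in `L`; the `SU(2)`, `d = 4` schema and two rows -/

/-- **Torus clustering on the whole READS-INCIDENCE tier-1 ball through the robust star door**, uniformly in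
`L ≥ 3` (`TorusClusteringOnBallFine`; implies `TorusClusteringOnBall` by `torusClusteringOnBall_of_fine`). [folklore] -/
theorem torusClusteringOnBallFine_of_robustStar (hd : 2 ≤ d) (hN : 1 ≤ N) {β ε₀ ε₁ R K c lam θ ρ : ℝ}
    (r : ℕ) (Kn : ℕ) (hK : 0 ≤ K) (hR : |β| / N * (2 * ((d : ℝ) - 1)) ≤ R) (hmod : OneLinkKRModulus N R K)
    (hε₁ : 0 ≤ ε₁) (hc : K * Real.exp ε₀ * (1 + 2 * Real.sqrt N * ε₁) * (|β| / N) ≤ c)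
    (hlam : Real.sqrt N * ε₁ ≤ lam) (hθ : θ = (2 * (d : ℝ) - 2) * c + lam) (hθ1 : θ < 1) (hcd : doorPoly d c < 1)
    (hρ : ρ = gaugeR d c + (lam + θ ^ Kn * (4 * d * lam)) / (1 - θ)) (hρ1 : ρ < 1) :
    TorusClusteringOnBallFine N d β ε₀ ε₁ r
      (4 * (2 * Real.sqrt N) ^ 2 * Real.exp (2 * ((1 - ρ) ^ 2 / (2 * (2 * ρ * (2 * d : ℕ) + 1)))))
      ((1 - ρ) ^ 2 / (2 * (2 * ρ * (2 * d : ℕ) + 1)) / ((max r 1 + 2 : ℕ) : ℝ)) :=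
  fun _L _ hL _W hW => clustersWith_of_robustStar_fine hd hN hL hK hR hmod hε₁ hc hlam hθ hθ1 hcd hρ hρ1 hW

/-- **SCHEMA, `SU(2)`, `d = 4`, READS-INCIDENCE ball**: same hypotheses as `su2_torusClusteringOnBallUpTo_star`, conclusion
`∃ A, ∃ m > 0, TorusClusteringOnBallFine 2 4 (β_W/2) ε₀ ε₁ r A m`. [folklore] -/
theorem su2_torusClusteringOnBallFine_star (Kn : ℕ) {βW ε₀ ε₁ c lam E S : ℝ} (hβ0 : 0 < βW) (hβ : βW ≤ 2 / 3)
    (hε₁ : 0 ≤ ε₁) (hE : Real.exp ε₀ ≤ E) (hS : Real.sqrt 2 ≤ S) (hc : E * (1 + 2 * S * ε₁) * (βW / 4) ≤ c)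
    (hlam : S * ε₁ ≤ lam) (hθ1 : 6 * c + lam < 1) (hcd : doorPoly 4 c < 1)
    (hρ1 : gaugeR 4 c + (lam + (6 * c + lam) ^ Kn * (16 * lam)) / (1 - (6 * c + lam)) < 1) (r : ℕ) :
    ∃ A m : ℝ, 0 < m ∧ TorusClusteringOnBallFine 2 4 (βW / 2) ε₀ ε₁ r A m := by
  have hS0 : 0 ≤ S := (Real.sqrt_nonneg _).trans hS
  have hE0 : 0 ≤ E := (Real.exp_pos _).le.trans hE
  have hc0 : 0 ≤ c := le_trans (by positivity) hc
  have hlam0 : 0 ≤ lam := le_trans (by positivity) hlam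
  set θ : ℝ := 6 * c + lam with hθ
  set ρ : ℝ := gaugeR 4 c + (lam + θ ^ Kn * (16 * lam)) / (1 - θ) with hρ
  have hθ0 : 0 ≤ θ := by positivity
  have hgR := gaugeR_lt_one_of_door (d := 4) (by norm_num) hc0 hcd
  have hρ0 : 0 ≤ ρ := by
    have : 0 ≤ θ ^ Kn := pow_nonneg hθ0 Kn
    have h1 : 0 < 1 - θ := by linarith
    rw [hρ]; exact add_nonneg hgR.1 (div_nonneg (by positivity) h1.le)
  have hβabs : |βW / 2| = βW / 2 := abs_of_pos (by positivity)
  have hR : |βW / 2| / ((2 : ℕ) : ℝ) * (2 * (((4 : ℕ) : ℝ) - 1)) ≤ 3 * βW / 2 := by rw [hβabs]; push_cast; linarith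
  have hc' : (1 : ℝ) * Real.exp ε₀ * (1 + 2 * Real.sqrt ((2 : ℕ) : ℝ) * ε₁) * (|βW / 2| / ((2 : ℕ) : ℝ)) ≤ c := by
    refine le_trans ?_ hc
    have h1 : Real.sqrt ((2 : ℕ) : ℝ) = Real.sqrt 2 := by norm_num
    rw [h1, one_mul, hβabs]
    have h2 : 1 + 2 * Real.sqrt 2 * ε₁ ≤ 1 + 2 * S * ε₁ := by nlinarith
    have h3 : 0 ≤ 1 + 2 * Real.sqrt 2 * ε₁ := by positivity
    have h4 : βW / 2 / ((2 : ℕ) : ℝ) = βW / 4 := by push_cast; ring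
    rw [h4]
    have hb : 0 ≤ βW / 4 := by positivity
    calc Real.exp ε₀ * (1 + 2 * Real.sqrt 2 * ε₁) * (βW / 4) ≤ E * (1 + 2 * Real.sqrt 2 * ε₁) * (βW / 4) := by
          gcongr
      _ ≤ E * (1 + 2 * S * ε₁) * (βW / 4) := by gcongr
  have hlam' : Real.sqrt ((2 : ℕ) : ℝ) * ε₁ ≤ lam := by
    have h1 : Real.sqrt ((2 : ℕ) : ℝ) = Real.sqrt 2 := by norm_num
    rw [h1]; exact le_trans (mul_le_mul_of_nonneg_right hS hε₁) hlam
  have hθ' : θ = (2 * ((4 : ℕ) : ℝ) - 2) * c + lam := by rw [hθ]; push_cast; ring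
  have hρ' : ρ = gaugeR 4 c + (lam + θ ^ Kn * (4 * ((4 : ℕ) : ℝ) * lam)) / (1 - θ) := by rw [hρ]; push_cast; ring
  have h := torusClusteringOnBallFine_of_robustStar (d := 4) (N := 2) (by norm_num) (by norm_num) r Kn zero_le_one
    hR (su2_quarterModulus hβ) hε₁ hc' hlam' hθ' hθ1 hcd hρ' hρ1
  refine ⟨_, _, ?_, h⟩
  have h1 : 0 < 1 - ρ := by linarith
  have hden : 0 < 2 * (2 * ρ * ((2 * 4 : ℕ) : ℝ) + 1) := by push_cast; nlinarith
  positivity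

/-- **ROW `(β_W, ε) = (1/8, 37/250)`, `SU(2)`, `d = 4`, ROBUST STAR DOOR, READS-INCIDENCE BALL**: every member of
`ClusterDomainFRFine (37/125) (37/250) r` clusters on every torus `(ℤ/L)⁴`, `L ≥ 3`, at tree coupling `1/16`; HYPOTHESIS-FREE. [folklore] -/
theorem su2_torusClusteringOnBallFine_star_oneEighth (r : ℕ) :
    ∃ A m : ℝ, 0 < m ∧ TorusClusteringOnBallFine 2 4 (1 / 16) (37 / 125) (37 / 250) r A m := by
  have e1 : (1 / 8 : ℝ) / 2 = 1 / 16 := by norm_num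
  have h := su2_torusClusteringOnBallFine_star 20 (βW := 1 / 8) (ε₀ := 37 / 125) (ε₁ := 37 / 250)
    (c := 59603 / 1000000) (lam := 41861 / 200000) (by norm_num) (by norm_num) (by norm_num) exp_le_37_125_star sqrt_two_le
    (by norm_num) (by norm_num) (by norm_num) (by unfold doorPoly; norm_num)
    (by unfold gaugeR Delta; norm_num) r
  rw [e1] at h
  exact h

/-- **ROW `(β_W, ε) = (1/4, 11/200)`, `SU(2)`, `d = 4`, ROBUST STAR DOOR, READS-INCIDENCE BALL**: every member of
`ClusterDomainFRFine (11/100) (11/200) r` clusters on every torus `(ℤ/L)⁴`, `L ≥ 3`, at tree coupling `1/8`; HYPOTHESIS-FREE. [folklore] -/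
theorem su2_torusClusteringOnBallFine_star_oneQuarter (r : ℕ) :
    ∃ A m : ℝ, 0 < m ∧ TorusClusteringOnBallFine 2 4 (1 / 8) (11 / 100) (11 / 200) r A m := by
  have e1 : (1 / 4 : ℝ) / 2 = 1 / 8 := by norm_num
  have h := su2_torusClusteringOnBallFine_star 20 (βW := 1 / 4) (ε₀ := 11 / 100) (ε₁ := 11 / 200)
    (c := 80621 / 1000000) (lam := 77783 / 1000000) (by norm_num) (by norm_num) (by norm_num) exp_le_11_100_star sqrt_two_le
    (by norm_num) (by norm_num) (by norm_num) (by unfold doorPoly; norm_num)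
    (by unfold gaugeR Delta; norm_num) r
  rw [e1] at h
  exact h

end Summit.Ventures.YMGap.RobustBall

end
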